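import Summits.AtomisticToContinuum.FouriersLaw.Theorems.BondHeatUncertaintyExtensiveSnapshotIrreversibilityEnergyWindowSmoothDuhamel

/-!
(SPLIT FOR THE 400-LINE CAP by the landing lane, hand-2 g30: this file = part 1 of 2; sequels `…BondHeatUncertaintyExtensiveSnapshotIrreversibilityEnergyWindowKernelTestClasses` import it in a chain; same namespace, all FQNs unchanged.)
# Crux `ExtensiveSnapshotIrreversibility` (stmt-AtomisticToContinuum-9121): test classes for (G1), (G1*)

Cell decomp-a2c, lens «grading / quantitative ladder», generation 77 (critic row 1064), part Rᵇ
beneath part P (`…EnergyWindowSmoothDuhamel`: `S3 ⟸ (Dˢ) ∧ (G1) ∧ (G1*)`).  The record keeps the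
two analytic atoms of the kernel leaf S3 in their measurable / `C¹` form

* `(G1)  EqualTemperatureBathGradient` — a weighted bound on the bath-momentum derivative
  `∂_{p_b} P⁰_r h` of the equal-temperature kernel for every **measurable** `|h| ≤ e^{θH}`;
* `(G1*) PerturbedKernelMomentumIBP` — a weighted integration by parts
  `|∫ ∂_{p_b} g dP^δ_s(z,·)| ≤ C s^{-b₀} M e^{θ₂H(z)}` for every `C¹` observable `|g| ≤ M e^{θ₁H}`.

The Malliavin–skeleton glue planned beneath them (part R, `SkeletonWeightMoments`) produces both
estimates only for **compactly supported smooth** observables (there the Gaussian integration by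
parts on a dyadic skeleton is an exact finite-dimensional identity).  This file is the proved
regularity cut that makes that enough:

* `PerturbedKernelMomentumIBPCompact` `(G1*ᶜᶜ)`: `(G1*)` for compactly supported `C¹` test
  functions, and `perturbedKernelMomentumIBP_of_compact : (G1*ᶜᶜ) → (G1*)` — smooth phase-space
  truncation `g χ_R` (`χ_R(w) = χ(w/R)` a scaled bump), the product rule
  `∂_b(gχ_R) = χ_R ∂_b g + g ∂_bχ_R` with `|∂_bχ_R| ≤ K/R`, dominated convergence `R → ∞` for
  `∂_b g ∈ L¹(P^δ_s(z,·))` (else the Bochner integral is `0`) and CEHR (3.4) for the weight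
  `e^{θ₁H}`; the converse is restriction;
* `EqualTemperatureBathLipschitz` `(G1ℓ)`: the two-sided Lipschitz form of `(G1)` along a bath
  momentum,
  `|P⁰_r h(w[p_b := t]) − P⁰_r h(w)| ≤ C r^{-a} |t − p_b| max(e^{θ₁H(w)}, e^{θ₁H(w[p_b:=t])})`,
  for **smooth compactly supported** `|h| ≤ e^{θH}` only, and
  `equalTemperatureBathGradient_of_lipschitz : (G1ℓ) → (G1)` — the Lipschitz bound passes to every
  measurable `|h| ≤ e^{θH}` by the weighted smooth density in `L¹(P_r(w[p_b:=t],·) + P_r(w,·))`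
  of part P §3, and a function with that two-sided modulus has `|deriv| ≤ C r^{-a} e^{θ₁H(w)}` at
  `t = p_b` (limit of slopes if differentiable, junk value `0` otherwise);
* the junction `K_fix ⟸ A0 ∧ A2 ∧ (Dˢ) ∧ (G1ℓ) ∧ (G1*ᶜᶜ) ∧ A3p ∧ A4`
  (`snapshotKLUpperExpansion_of_atoms₇R`).

No new leaves: `(G1ℓ)`, `(G1*ᶜᶜ)` are the targets of the skeleton glue (parts S–V of the plan in
part R); they are implied by the density cores `(G1ᶜ)`, `(G1*ᶜ)` of part O exactly as `(G1)`,
`(G1*)` are.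
-/

noncomputable section

namespace Summit.AtomisticToContinuum.FouriersLaw.Theorems.ExtensiveSnapshotIrreversibility.EnergyWindow

open MeasureTheory ProbabilityTheory Filter Topology Real Set Metric
open scoped ENNReal NNReal ContDiff
open Literature.MathematicalPhysics.KineticTheory.HeatConduction

variable {N : ℕ}

/-! ## 1. The two test-class statements -/

/-- **(G1*ᶜᶜ) `PerturbedKernelMomentumIBPCompact`** — `PerturbedKernelMomentumIBP` restricted to
compactly supported `C¹` observables: for `0 < θ₁ < θ₂ < 1/T` there are `b₀ < 1`, `δ₀ > 0`, `C`
with `|∫ ∂_{p_b} g dP^δ_s(z,·)| ≤ C s^{-b₀} M e^{θ₂H(z)}` for `|δ| < δ₀`, `s ∈ (0,1]`, `b` a bath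
site and every compactly supported `g ∈ C¹` with `|g| ≤ M e^{θ₁H}`.
(after CuneoEckmannHairerReyBellet2018, §3 eq. (3.4)–(3.6)) [route leaf · named hypothesis of this cell, NOT filed as a literature fact] -/
def PerturbedKernelMomentumIBPCompact : Prop :=
  ∀ ω₂ lam β γ : ℝ, 0 < ω₂ → 0 < lam → 0 < β → 0 < γ →
    ∀ T : ℝ, 0 < T → ∀ (N : ℕ) (hN : 2 ≤ N), ∀ θ₁ θ₂ : ℝ, 0 < θ₁ → θ₁ < θ₂ → θ₂ < 1 / T →
      ∃ b₀ δ₀ C : ℝ, b₀ < 1 ∧ 0 < δ₀ ∧ ∀ δ : ℝ, |δ| < δ₀ →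
        ∀ s : ℝ, 0 < s → s ≤ 1 → ∀ b : Fin N, (b = leftBath N hN ∨ b = rightBath N hN) →
          ∀ M : ℝ, 0 ≤ M → ∀ g : PhaseSpace N → ℝ, ContDiff ℝ 1 g → HasCompactSupport g →
            (∀ w, |g w| ≤ M * Real.exp (θ₁ * (pinnedChain ω₂ lam β γ).hamiltonian N w)) →
            ∀ z : PhaseSpace N,
              |∫ w, partialP b g w ∂(pertKernel ω₂ lam β γ T δ N s z)| ≤
                C * s ^ (-b₀) * M * Real.exp (θ₂ * (pinnedChain ω₂ lam β γ).hamiltonian N z)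

/-- **(G1ℓ) `EqualTemperatureBathLipschitz`** — the two-sided Lipschitz form of the
equal-temperature bath-gradient atom `(G1)` on smooth compactly supported observables: for
`0 < θ < θ₁ < 1/T` there are `a < 1` and `C` with
`|P⁰_r h(w[p_b := t]) − P⁰_r h(w)| ≤ C r^{-a} |t − p_b(w)| max(e^{θ₁H(w)}, e^{θ₁H(w[p_b := t])})`
for `r ∈ (0,1]`, every smooth compactly supported `|h| ≤ e^{θH}`, both bath sites `b`, every `w`
and `t` (`P⁰_r h = eqKernelFun`, the kernel at both temperatures `T`).
(after CuneoEckmannHairerReyBellet2018, §3 eq. (3.5)) [route leaf · named hypothesis of this cell, NOT filed as a literature fact] -/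
def EqualTemperatureBathLipschitz : Prop :=
  ∀ ω₂ lam β γ : ℝ, 0 < ω₂ → 0 < lam → 0 < β → 0 < γ →
    ∀ T : ℝ, 0 < T → ∀ (N : ℕ) (hN : 2 ≤ N), ∀ θ θ₁ : ℝ, 0 < θ → θ < θ₁ → θ₁ < 1 / T →
      ∃ a C : ℝ, a < 1 ∧ ∀ r : ℝ, 0 < r → r ≤ 1 →
        ∀ (h : PhaseSpace N → ℝ), ContDiff ℝ ∞ h → HasCompactSupport h →
          (∀ y, |h y| ≤ Real.exp (θ * (pinnedChain ω₂ lam β γ).hamiltonian N y)) →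
          ∀ b : Fin N, (b = leftBath N hN ∨ b = rightBath N hN) →
            ∀ (w : PhaseSpace N) (t : ℝ),
              |eqKernelFun ω₂ lam β γ T N h r (w.1, Function.update w.2 b t) -
                  eqKernelFun ω₂ lam β γ T N h r w| ≤
                C * r ^ (-a) * |t - w.2 b| *
                  max (Real.exp (θ₁ * (pinnedChain ω₂ lam β γ).hamiltonian N w))
                    (Real.exp (θ₁ * (pinnedChain ω₂ lam β γ).hamiltonian N
                      (w.1, Function.update w.2 b t)))

/-- `(G1*) → (G1*ᶜᶜ)` (restriction of the test class). [folklore] -/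
theorem perturbedKernelMomentumIBPCompact_of_momentumIBP (hI : PerturbedKernelMomentumIBP) :
    PerturbedKernelMomentumIBPCompact := by
  intro ω₂ lam β γ hω hl hβ hγ T hT N hN θ₁ θ₂ hθ₁ hθ₁₂ hθ₂
  obtain ⟨b₀, δ₀, C, hb₀, hδ₀, hmain⟩ := hI ω₂ lam β γ hω hl hβ hγ T hT N hN θ₁ θ₂ hθ₁ hθ₁₂ hθ₂
  exact ⟨b₀, δ₀, C, hb₀, hδ₀, fun δ hδ s hs0 hs1 b hb M hM g hgC _ hgM z =>
    hmain δ hδ s hs0 hs1 b hb M hM g hgC hgM z⟩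

/-! ## 2. Calculus of `∂_{p_b}` and the scaled phase-space cutoff -/

/-- The coordinate path `τ ↦ w[p_b := τ]` has velocity `(0, e_b)`. [folklore] -/
theorem hasDerivAt_updatePath (b : Fin N) (w : PhaseSpace N) (t : ℝ) :
    HasDerivAt (fun τ : ℝ => ((w.1, Function.update w.2 b τ) : PhaseSpace N))
      ((0 : Fin N → ℝ), Pi.single b (1 : ℝ)) t :=
  (hasDerivAt_const t w.1).prodMk (hasDerivAt_update w.2 b t)

/-- The coordinate path is continuous. [folklore] -/
theorem continuous_updatePath (b : Fin N) (w : PhaseSpace N) :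
    Continuous fun τ : ℝ => ((w.1, Function.update w.2 b τ) : PhaseSpace N) :=
  continuous_iff_continuousAt.2 fun t => (hasDerivAt_updatePath b w t).continuousAt

/-- `w[p_b := p_b(w)] = w`. [folklore] -/
@[simp] theorem updatePath_self (b : Fin N) (w : PhaseSpace N) :
    ((w.1, Function.update w.2 b (w.2 b)) : PhaseSpace N) = w := by
  rw [Function.update_eq_self]

/-- `∂_{p_b} f(w) = Df(w)(0, e_b)` for `f` differentiable at `w` (pointwise form of
`partialP_eq_fderiv`, via `partialP_eq_lineDeriv`). [folklore] -/
theorem partialP_eq_fderiv_apply (b : Fin N) {f : PhaseSpace N → ℝ} {w : PhaseSpace N}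
    (hf : DifferentiableAt ℝ f w) :
    partialP b f w = fderiv ℝ f w ((0 : Fin N → ℝ), Pi.single b 1) := by
  rw [partialP_eq_lineDeriv, hf.lineDeriv_eq_fderiv]

/-- For `f ∈ C¹`, `∂_{p_b} f` is continuous. [folklore] -/
theorem continuous_partialP_of_contDiff (b : Fin N) {f : PhaseSpace N → ℝ} (hf : ContDiff ℝ 1 f) :
    Continuous (partialP b f) := by
  rw [partialP_eq_fderiv (hf.differentiable one_ne_zero)]
  exact (hf.continuous_fderiv one_ne_zero).clm_apply continuous_const

/-- **Product rule** `∂_{p_b}(fg) = f ∂_{p_b} g + g ∂_{p_b} f`, pointwise `fun`-form under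
differentiability AT the point (the tree's `partialP_mul` of `PhaseSpacePoisson` is the global
`f * g` form; not imported here to keep the import cone of the lineage). [folklore] -/
theorem partialP_fun_mul (b : Fin N) {f g : PhaseSpace N → ℝ} {w : PhaseSpace N}
    (hf : DifferentiableAt ℝ f w) (hg : DifferentiableAt ℝ g w) :
    partialP b (fun y => f y * g y) w = f w * partialP b g w + g w * partialP b f w := by
  have hfg : DifferentiableAt ℝ (fun y => f y * g y) w := hf.mul hg
  rw [partialP_eq_fderiv_apply b hfg, partialP_eq_fderiv_apply b hf,
    partialP_eq_fderiv_apply b hg, fderiv_fun_mul hf hg]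
  rfl

/-- A fixed bump profile on phase space (sup norm; radii `1 < 2`); a scaled `ContDiffBump`, not the
tree's radial `phaseCutoff` (LangevinChainLimitFlow), because the truncation argument needs the
derivative bound `|∂_{p_b} χ_R| ≤ K/R`, immediate for `χ(w/R)`. -/
def ewBump (N : ℕ) : ContDiffBump (0 : PhaseSpace N) := ⟨1, 2, one_pos, one_lt_two⟩

/-- The scaling `w ↦ R⁻¹ w` as a continuous linear map. -/
def ewScale (N : ℕ) (R : ℝ) : PhaseSpace N →L[ℝ] PhaseSpace N :=
  R⁻¹ • ContinuousLinearMap.id ℝ (PhaseSpace N)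

/-- `ewScale N R w = R⁻¹ • w`. -/
@[simp] theorem ewScale_apply (R : ℝ) (w : PhaseSpace N) : ewScale N R w = R⁻¹ • w := rfl

/-- The scaled cutoff `χ_R(w) = χ(w/R)`. -/
def ewCutoff (N : ℕ) (R : ℝ) (w : PhaseSpace N) : ℝ := ewBump N (ewScale N R w)

/-- `χ_R` is smooth. [folklore] -/
theorem ewCutoff_contDiff {n : ℕ∞} (R : ℝ) : ContDiff ℝ n (ewCutoff N R) :=
  (ewBump N).contDiff.comp (ewScale N R).contDiff

/-- `0 ≤ χ_R`. [folklore] -/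
theorem ewCutoff_nonneg (R : ℝ) (w : PhaseSpace N) : 0 ≤ ewCutoff N R w :=
  (ewBump N).nonneg

/-- `χ_R ≤ 1`. [folklore] -/
theorem ewCutoff_le_one (R : ℝ) (w : PhaseSpace N) : ewCutoff N R w ≤ 1 :=
  (ewBump N).le_one

/-- `|χ_R| ≤ 1`. [folklore] -/
theorem abs_ewCutoff_le_one (R : ℝ) (w : PhaseSpace N) : |ewCutoff N R w| ≤ 1 := by
  rw [abs_of_nonneg (ewCutoff_nonneg R w)]
  exact ewCutoff_le_one R w

/-- `χ_R = 1` on the ball of radius `R`. [folklore] -/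
theorem ewCutoff_eq_one {R : ℝ} (hR : 0 < R) {w : PhaseSpace N} (hw : ‖w‖ ≤ R) :
    ewCutoff N R w = 1 := by
  apply (ewBump N).one_of_mem_closedBall
  rw [mem_closedBall, dist_zero_right, ewScale_apply, norm_smul, norm_inv,
    Real.norm_of_nonneg hR.le]
  show R⁻¹ * ‖w‖ ≤ 1
  rw [inv_mul_le_iff₀ hR, mul_one]
  exact hw

/-- `χ_R = 0` off the ball of radius `2R`. [folklore] -/
theorem ewCutoff_eq_zero {R : ℝ} (hR : 0 < R) {w : PhaseSpace N} (hw : 2 * R ≤ ‖w‖) :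
    ewCutoff N R w = 0 := by
  apply (ewBump N).zero_of_le_dist
  rw [dist_zero_right, ewScale_apply, norm_smul, norm_inv, Real.norm_of_nonneg hR.le]
  show (2 : ℝ) ≤ R⁻¹ * ‖w‖
  rw [le_inv_mul_iff₀ hR]
  linarith

/-- `χ_R` has compact support. [folklore] -/
theorem hasCompactSupport_ewCutoff {R : ℝ} (hR : 0 < R) : HasCompactSupport (ewCutoff N R) :=
  HasCompactSupport.intro (isCompact_closedBall (0 : PhaseSpace N) (2 * R)) fun w hw =>
    ewCutoff_eq_zero hR (by rw [mem_closedBall, dist_zero_right, not_le] at hw; exact hw.le)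

/-- Chain rule for the scaled cutoff: `Dχ_R(w)v = R⁻¹ Dχ(w/R)v`. [folklore] -/
theorem fderiv_ewCutoff_apply (R : ℝ) (w v : PhaseSpace N) :
    fderiv ℝ (ewCutoff N R) w v = R⁻¹ * fderiv ℝ (ewBump N) (ewScale N R w) v := by
  have hb : DifferentiableAt ℝ (ewBump N) (ewScale N R w) :=
    ((ewBump N).contDiff (n := 1)).differentiable (by simp) _
  have hc : ewCutoff N R = (ewBump N) ∘ (ewScale N R) := rfl
  rw [hc, fderiv_comp w hb (ewScale N R).differentiableAt, (ewScale N R).fderiv]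
  simp only [ContinuousLinearMap.coe_comp, Function.comp_apply, ewScale_apply, map_smul,
    smul_eq_mul]

/-- A uniform bound on a directional derivative of the profile (continuous, compactly supported).
[folklore] -/
theorem exists_bound_fderiv_ewBump (N : ℕ) (v : PhaseSpace N) :
    ∃ K : ℝ, 0 ≤ K ∧ ∀ w : PhaseSpace N, |fderiv ℝ (ewBump N) w v| ≤ K := by
  obtain ⟨K, hK⟩ := (((ewBump N).contDiff (n := 1)).continuous_fderiv (by simp))
    |>.bounded_above_of_compact_support ((ewBump N).hasCompactSupport.fderiv (𝕜 := ℝ))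
  refine ⟨max K 0 * ‖v‖, by positivity, fun w => ?_⟩
  rw [← Real.norm_eq_abs]
  exact ((fderiv ℝ (ewBump N) w).le_opNorm v).trans
    (mul_le_mul_of_nonneg_right ((hK w).trans (le_max_left _ _)) (norm_nonneg _))

/-- `|∂_{p_b} χ_R| ≤ K/R`. [folklore] -/
theorem abs_partialP_ewCutoff_le {b : Fin N} {K : ℝ}
    (hK : ∀ w : PhaseSpace N, |fderiv ℝ (ewBump N) w ((0 : Fin N → ℝ), Pi.single b 1)| ≤ K)
    {R : ℝ} (hR : 0 < R) (w : PhaseSpace N) : |partialP b (ewCutoff N R) w| ≤ K / R := by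
  rw [partialP_eq_fderiv_apply b (((ewCutoff_contDiff (n := 1) R).differentiable (by simp)) w),
    fderiv_ewCutoff_apply, abs_mul, abs_inv, abs_of_pos hR, div_eq_inv_mul]
  exact mul_le_mul_of_nonneg_left (hK _) (inv_nonneg.2 hR.le)

end Summit.AtomisticToContinuum.FouriersLaw.Theorems.ExtensiveSnapshotIrreversibility.EnergyWindow

end
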